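import Summits.PneNP.PneNP.Theses.CanonicalForms
import Summits.PneNP.PneNP.Theorems.LearningAssembly
import Literature.Computability.Complexity.ClayProblemProofs
import Literature.Computability.Complexity.NondeterministicProofs

/-!
# Route CanonicalForms — `CookBridge` (stmt-PneNP-10630)

If the prelude classes over `{0,1}` differ (`Classes.P ≠ Nondeterministic.NP`, Mathlib `TM2` model) then Cook's Clay
statement `PneNP` holds: `Literature.Learning.pneNP_of_P_ne_NP` with the three model bridges discharged
(`P_bool_eq_holds`, `NP_bool_eq_holds`, `P_subset_NP_holds`).
-/

set_option linter.dupNamespace false -- `Summit.PneNP.PneNP.…`: summit = sub-problem name (D-0017 single-conjunct layout)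

namespace Summit.PneNP.PneNP.Theorems

/-- **Support item `CookBridge` of route CanonicalForms (stmt-PneNP-10630)**: `Classes.P ≠ NP → PneNP`, by
`Literature.Learning.pneNP_of_P_ne_NP` and the proved model bridges. [cite: CookClay2006, §1] [folklore] -/
theorem canonicalForms_cookBridge_proof : Summit.PneNP.PneNP.Theses.CanonicalForms.CookBridge := by
  unfold Summit.PneNP.PneNP.Theses.CanonicalForms.CookBridge
  exact Literature.Learning.pneNP_of_P_ne_NP Literature.Computability.Complexity.P_bool_eq_holds
    Literature.Computability.Complexity.NP_bool_eq_holds Literature.Computability.Complexity.P_subset_NP_holds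

end Summit.PneNP.PneNP.Theorems
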